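import Literature.Computability.Complexity.BoundedArithmetic
import Literature.Computability.MetaComplexity.BoundedArithT2SuccPIND
import HarnessLib

/-!
# Bounded arithmetic (`pnp` walls): discharges of the inclusion `S₂ⁱ ⊆ T₂ⁱ` (`i ≥ 1`)

Sibling proof file of `BoundedArithmetic.lean` (D-0014: named facts `def X : Prop` are discharged
as `theorem X_holds : X`), complementary to `BoundedArithmeticProofs.lean` (which treats the
direction `T₂ⁱ ⊆ S₂ⁱ⁺¹` and Buss's conservation theorem).  From the inclusion `S₂ⁱ ⊆ T₂ⁱ` for
`i ≥ 1` — `T₂ⁱ` proves every `Σᵇᵢ-PIND` axiom, `S2_extends_T2_holds`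
(`Literature/Computability/MetaComplexity/BoundedArithT2SuccPIND.lean`: in a model of
`BASIC + Σᵇᵢ-IND`, `i ≥ 1`, polynomial induction holds for every `Σᵇᵢ` formula with parameters,
by Krajíček's prefix argument `ψ(x) :≡ φ(aₓ)`; Buss 1986, Thm. 2.6 / §2.6; Buss 1998, §1.3.5,
Theorem (1): "`T₂ⁱ ⊇ S₂ⁱ`"; Krajíček 1995, Lemma 5.2.8 with Lemma 5.2.5) — this file discharges
the named facts of `BoundedArithmetic.lean`

* `S2_extends_to_T2` (`S2_extends_to_T2_holds`): `T₂ⁱ` extends `S₂ⁱ` for `i ≥ 1`;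
* `S2_succ_extends_to_T2_succ` (`S2_succ_extends_to_T2_succ_holds`): successor form;
* `models_T2_of_models_S2` (`models_T2_of_models_S2_holds`): every consequence (`⊨ᵇ`) of `S₂ⁱ`
  is a consequence of `T₂ⁱ`, `i ≥ 1`;
* `isSigmabDefinable_T2_of_isSigmabDefinable_S2`
  (`isSigmabDefinable_T2_of_isSigmabDefinable_S2_holds`): a function `Σᵇⱼ`-definable in `S₂ⁱ`,
  `i ≥ 1`, is `Σᵇⱼ`-definable in `T₂ⁱ`,

exactly by the interim proofs preserved as comments in `BoundedArithmetic.lean`, with the prelude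
fact `S2_extends_T2` replaced by its discharge `S2_extends_T2_holds`.

## References

* S. R. Buss, *Bounded Arithmetic*, Bibliopolis 1986, Ch. 2, Thm. 2.6 and §2.6 (`S₂ⁱ ⊆ T₂ⁱ`,
  `i ≥ 1`).
* S. R. Buss, *First-order proof theory of arithmetic*, in: Handbook of Proof Theory (S. Buss,
  ed.), Elsevier 1998, Ch. II, §1.3.5, Theorem (Buss [1986]) (1), p. 105: for `i ≥ 1`,
  `T₂ⁱ ⊇ S₂ⁱ` ("a proof of (1) can be found in Buss [1986, sect. 2.6]").
* J. Krajíček, *Bounded Arithmetic, Propositional Logic and Complexity Theory*, CUP 1995,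
  Lemma 5.2.5 (p. 67) and Lemma 5.2.8 (p. 68): for `i ≥ 1`, `S₂ⁱ ⊆ T₂ⁱ ⊆ S₂ⁱ⁺¹`.

## Design choices

* Nothing is restated: the four theorems have literally the types of the named facts of
  `BoundedArithmetic.lean`; all mathematical content is `MetaComplexity.S2_extends_T2_holds`.
* As in the sources and in the facts themselves, only `i ≥ 1` is covered; nothing is claimed
  about `T₂⁰` versus `S₂⁰`.
-/

namespace Literature.Computability.Complexity

open FirstOrder FirstOrder.Language MetaComplexity

/-- **Discharge of `S2_extends_to_T2`**: for `i ≥ 1`, `T₂ⁱ` extends `S₂ⁱ` — every axiom of `S₂ⁱ`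
(the axioms of `BASIC` and the `Σᵇᵢ-PIND` axioms) is a consequence (`⊨ᵇ`) of `T₂ⁱ` (Buss 1986,
Thm. 2.6 / §2.6: `S₂ⁱ ⊆ T₂ⁱ`; Buss 1998, §1.3.5, Theorem (1); Krajíček 1995, Lemma 5.2.8 with
Lemma 5.2.5); this is `MetaComplexity.S2_extends_T2_holds`.
[cite: Krajicek1995, Lemma 5.2.8 (p. 68)] [cite: Buss1986, Thm. 2.6 / §2.6] -/
theorem S2_extends_to_T2_holds : S2_extends_to_T2 := by
  intro i hi
  exact S2_extends_T2_holds hi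

/-- **Discharge of `S2_succ_extends_to_T2_succ`**: `T₂ⁱ⁺¹` extends `S₂ⁱ⁺¹` for every `i` (the
successor form of `S2_extends_to_T2_holds`; Buss 1986, Thm. 2.6; Krajíček 1995, Lemma 5.2.8).
[cite: Krajicek1995, Lemma 5.2.8 (p. 68)] -/
theorem S2_succ_extends_to_T2_succ_holds : S2_succ_extends_to_T2_succ := by
  intro i
  exact S2_extends_T2_holds (Nat.succ_pos i)

/-- **Discharge of `models_T2_of_models_S2`**: for `i ≥ 1`, every consequence of `S₂ⁱ` is a
consequence of `T₂ⁱ` — semantic-consequence form of `S₂ⁱ ⊆ T₂ⁱ` (Buss 1986, Thm. 2.6 / §2.6;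
Buss 1998, §1.3.5, Theorem (1); Krajíček 1995, Lemma 5.2.8): if every model of `T₂ⁱ` satisfies
the axioms of `S₂ⁱ` (`S2_extends_T2_holds`) then it satisfies every `φ` with `S₂ⁱ ⊨ᵇ φ`
(`Theory.Extends.models`). [cite: Krajicek1995, Lemma 5.2.8 (p. 68)] [cite: Buss1986, Thm. 2.6 / §2.6] -/
theorem models_T2_of_models_S2_holds : models_T2_of_models_S2 := by
  intro i hi φ h
  exact (S2_extends_T2_holds hi).models h

/-- **Discharge of `isSigmabDefinable_T2_of_isSigmabDefinable_S2`**: a function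
`Σᵇⱼ`-definable in `S₂ⁱ`, `i ≥ 1`, is `Σᵇⱼ`-definable in `T₂ⁱ` (from `S₂ⁱ ⊆ T₂ⁱ`, Buss 1986,
Thm. 2.6 with Ch. 5; Krajíček 1995, Lemma 5.2.8: the defining formula, its totality and its
uniqueness sentences are consequences of `T₂ⁱ` as well, `IsSigmabDefinable.mono_theory`).
[cite: Krajicek1995, Lemma 5.2.8 (p. 68)] [cite: Buss1986, Thm. 2.6 with Ch. 5] -/
theorem isSigmabDefinable_T2_of_isSigmabDefinable_S2_holds :
    isSigmabDefinable_T2_of_isSigmabDefinable_S2 := by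
  intro i j hi f hf
  exact hf.mono_theory (S2_extends_T2_holds hi)

end Literature.Computability.Complexity
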